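import Mathlib.GroupTheory.Abelianization.Defs
import Mathlib.GroupTheory.Commutator.Basic
import Mathlib.GroupTheory.QuotientGroup.Basic
import Literature.IUT.HodgeTheaters.InitialThetaData
import HarnessLib

/-!
# [IUTchI] Remarks 3.1.2 (iii), 3.1.4, 3.1.5 following Definition 3.1

S. Mochizuki, *Inter-universal Teichmüller theory I*, §3, Remarks 3.1.1–3.1.7 (kurims final
manuscript May 2020, pp. 63–69) [claim: Mochizuki2012, status: disputed]. Companion to
`InitialThetaData.lean` (Def. 3.1) and `KappaCoricFunctions.lean` (Rmk 3.1.7). Definitions and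
`Prop`-valued statements; the two "it follows immediately" items that are pure group theory or
immediate from Def. 3.1 are PROVED.

* **Rmk 3.1.2 (i)** (p. 64): "the open subgroup `Π_{X_K} ⊆ Π_{C_K}` may be constructed
  group-theoretically from the topological group `Π_{C_K}`" — typed as a statement in the reading
  "characteristic: carried to itself by every bicontinuous automorphism of `Π_{C_K}`" (the cuspidal
  decomposition groups used in the printed argument are not in the interface).
* **Rmk 3.1.2 (iii)** (p. 64): "the tautological extension `1 → Δ_Θ → Δ^Θ_X → Δ^ell_X → 1` — where
  `Δ_Θ := [Δ_X, Δ_X]/[Δ_X, [Δ_X, Δ_X]]`; `Δ^Θ_X := Δ_X/[Δ_X, [Δ_X, Δ_X]]`; `Δ^ell_X := Δ_X^ab`"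
  (recalled from [EtTh] §2). Typed for an arbitrary group `Δ` (`doubleCommutator`,
  `ThetaQuotient`, `DeltaTheta`, `thetaToEll`), with exactness in the middle and centrality of
  `Δ_Θ` PROVED. MODELLING NOTE: abstract commutator subgroups; in the text `Δ_X` is a profinite
  group and the brackets are the profinite ones. NOT typed: the cyclotome `M_X` of [AbsTopIII]
  Thm. 1.9 and the tautological isomorphism `M_X ⥲ l·Δ_Θ` (interface of abc-iut-L4-t1), (i), (ii)
  (the "Θ-approach" convention), (iv) (analogy).
* **Rmk 3.1.4** (p. 65): stable models at `v ∈ V̲^bad` — for the once-punctured elliptic curve `X`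
  this is the multiplicative (hence semistable) reduction recorded in Def. 3.1 (b): PROVED from the
  structure. (The statements for `X̲→_v`, `X̲_v` concern the interface orbicurves; not typed.)
* **Rmk 3.1.5** (p. 65), first sentence: "`K` is Galois over `F_mod`" ([IUTchIV] Prop. 1.8 (iv)) —
  typed as a statement (stability of `K ⊆ F̄` under `Aut(F̄/F_mod)`). NOT typed: the algebraic stack
  `S_mod = Spec(𝒪_K) // Gal(K/F_mod)` and the stack-theoretic Frobenioids of [FrdI] Ex. 6.3
  (owner abc-iut-L1-t3).
* **Rmk 3.1.6** (p. 66, erratum to [EtTh]: "one must in fact assume that the integer `l` is odd …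
  this is the only case that is of interest"): for initial Θ-data `l` is an odd prime — PROVED from
  Def. 3.1 (c) (`l` prime, `l ≥ 5`).
* Rmk 3.1.1 (tempered fundamental groups, [SemiAnbd] Ex. 3.10: abc-iut-L3-t2) and Rmk 3.1.3 (which
  data determine which — a meta-remark) carry no separate declaration.
-/

namespace Literature.IUT.HodgeTheaters

open NumberField IsDedekindDomain

universe u v w

/-! ### Remark 3.1.2 (iii): `Δ_Θ`, `Δ^Θ_X`, `Δ^ell_X` -/

section ThetaQuotients

variable (Δ : Type u) [Group Δ]

/-- `[Δ, [Δ, Δ]]` (Rmk 3.1.2 (iii)). [claim: Mochizuki2012, status: disputed] -/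
def doubleCommutator : Subgroup Δ := ⁅(⊤ : Subgroup Δ), commutator Δ⁆

/-- `[Δ, [Δ, Δ]]` is normal (an instance on the new definition `doubleCommutator`; Mathlib's
`Subgroup.commutator_normal`). [claim: Mochizuki2012, status: disputed] -/
instance doubleCommutator_normal : (doubleCommutator Δ).Normal := by
  unfold doubleCommutator; infer_instance

/-- `[Δ, [Δ, Δ]] ⊆ [Δ, Δ]`. [claim: Mochizuki2012, status: disputed] -/
theorem doubleCommutator_le_commutator : doubleCommutator Δ ≤ commutator Δ := by
  rw [doubleCommutator, commutator_def]
  exact Subgroup.commutator_mono le_rfl le_top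

/-- `Δ^Θ_X := Δ_X/[Δ_X, [Δ_X, Δ_X]]` (Rmk 3.1.2 (iii)). [claim: Mochizuki2012, status: disputed] -/
abbrev ThetaQuotient : Type u := Δ ⧸ doubleCommutator Δ

/-- `Δ_Θ := [Δ_X, Δ_X]/[Δ_X, [Δ_X, Δ_X]] ⊆ Δ^Θ_X` (Rmk 3.1.2 (iii)). [claim: Mochizuki2012, status: disputed] -/
def DeltaTheta : Subgroup (ThetaQuotient Δ) := (commutator Δ).map (QuotientGroup.mk' _)

/-- `Δ^ell_X := Δ_X^ab` (Rmk 3.1.2 (iii)) — Mathlib's `Abelianization`. [claim: Mochizuki2012, status: disputed] -/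
abbrev EllQuotient : Type u := Abelianization Δ

/-- The surjection `Δ^Θ_X ↠ Δ^ell_X` of the tautological extension (Rmk 3.1.2 (iii)).
[claim: Mochizuki2012, status: disputed] -/
def thetaToEll : ThetaQuotient Δ →* EllQuotient Δ :=
  QuotientGroup.lift (doubleCommutator Δ) Abelianization.of
    (by rw [Abelianization.ker_of]; exact doubleCommutator_le_commutator Δ)

/-- Exactness of `1 → Δ_Θ → Δ^Θ_X → Δ^ell_X → 1` in the middle: `Ker(Δ^Θ_X ↠ Δ^ell_X) = Δ_Θ`
(Rmk 3.1.2 (iii), "tautological extension") — PROVED. [claim: Mochizuki2012, status: disputed] -/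
theorem ker_thetaToEll : (thetaToEll Δ).ker = DeltaTheta Δ := by
  rw [thetaToEll, QuotientGroup.ker_lift, Abelianization.ker_of]
  rfl

/-- `Δ^Θ_X ↠ Δ^ell_X` is surjective (exactness on the right) — PROVED.
[claim: Mochizuki2012, status: disputed] -/
theorem thetaToEll_surjective : Function.Surjective (thetaToEll Δ) := by
  intro y
  exact QuotientGroup.induction_on y fun x => ⟨QuotientGroup.mk x, rfl⟩

/-- `Δ_Θ` is central in `Δ^Θ_X` (the extension of Rmk 3.1.2 (iii) is central, [EtTh] §1) — PROVED.
[claim: Mochizuki2012, status: disputed] -/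
theorem DeltaTheta_le_center : DeltaTheta Δ ≤ Subgroup.center (ThetaQuotient Δ) := by
  rintro _ ⟨x, hx, rfl⟩
  rw [Subgroup.mem_center_iff]
  intro g
  obtain ⟨g, rfl⟩ := QuotientGroup.mk_surjective g
  have hmem : g * x * g⁻¹ * x⁻¹ ∈ doubleCommutator Δ :=
    Subgroup.commutator_mem_commutator (Subgroup.mem_top g) hx
  have h1 : (QuotientGroup.mk (s := doubleCommutator Δ) (g * x * g⁻¹ * x⁻¹)) = 1 :=
    (QuotientGroup.eq_one_iff _).mpr hmem
  change QuotientGroup.mk g * QuotientGroup.mk x = QuotientGroup.mk x * QuotientGroup.mk g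
  have : QuotientGroup.mk (s := doubleCommutator Δ) (g * x * g⁻¹ * x⁻¹) =
      QuotientGroup.mk g * QuotientGroup.mk x * (QuotientGroup.mk g)⁻¹ * (QuotientGroup.mk x)⁻¹ := by
    simp only [QuotientGroup.mk_mul, QuotientGroup.mk_inv]
  rw [this] at h1
  calc QuotientGroup.mk g * QuotientGroup.mk x
      = (QuotientGroup.mk g * QuotientGroup.mk x * (QuotientGroup.mk g)⁻¹ * (QuotientGroup.mk x)⁻¹) *
          (QuotientGroup.mk x * QuotientGroup.mk g) := by group
    _ = QuotientGroup.mk x * QuotientGroup.mk g := by rw [h1, one_mul]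

end ThetaQuotients

/-! ### Remarks 3.1.2 (iii), 3.1.4, 3.1.5 for initial Θ-data -/

section ForData

variable {F : Type u} {K : Type v} {Fbar : Type w} [Field F] [NumberField F] [Field K]
  [NumberField K] [Algebra F K] [Field Fbar] [Algebra F Fbar] [Algebra K Fbar]
  {E : WeierstrassCurve F} [E.IsElliptic] {l : ℕ} {P : BadPlacePredicates K}
  (D : InitialThetaData F K Fbar E l P)

namespace InitialThetaData

/-- `Δ^Θ_X` for the `Δ_X` of the initial Θ-data (Rmk 3.1.2 (iii)). [claim: Mochizuki2012, status: disputed] -/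
abbrev DeltaXTheta : Type w := ThetaQuotient D.DeltaX

/-- `Δ_Θ ⊆ Δ^Θ_X` for the `Δ_X` of the initial Θ-data (Rmk 3.1.2 (iii); "the cyclotome `l·Δ_Θ`
plays a central role in the theory of [EtTh]"). [claim: Mochizuki2012, status: disputed] -/
def DeltaThetaX : Subgroup D.DeltaXTheta := DeltaTheta D.DeltaX

/-- Remark 3.1.2 (i), p. 64: "the open subgroup `Π_{X_K} ⊆ Π_{C_K}` may be constructed
group-theoretically from the topological group `Π_{C_K}`" — typed as: `Π_{X_K}` is carried onto
itself by every bicontinuous group automorphism of `Π_{C_K}` (a statement; the printed proof via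
cuspidal decomposition groups, [AbsTopI] Lemma 4.5, is not reproduced).
[claim: Mochizuki2012, status: disputed] -/
def PiXKCharacteristic (D : InitialThetaData F K Fbar E l P) : Prop :=
  ∀ φ : D.PiCK ≃* D.PiCK, Continuous φ → Continuous φ.symm →
    (D.PiXK.subgroupOf D.PiCK).map φ.toMonoidHom = D.PiXK.subgroupOf D.PiCK

/-- `l·Δ_Θ`: the image of multiplication by `l` on `Δ_Θ` (Rmk 3.1.2 (iii): "`M_X ⥲ (l·Δ_Θ)` [i.e.,
since `[Δ_X : Δ_X̲] = l`]"). [claim: Mochizuki2012, status: disputed] -/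
def lDeltaThetaX : Subgroup D.DeltaXTheta :=
  Subgroup.closure ((fun x : D.DeltaXTheta => x ^ l) '' (D.DeltaThetaX : Set D.DeltaXTheta))

/-- Remark 3.1.4 (the part about `X`), p. 65: "at each `v ∈ V̲^bad` … `X_v` admits a stable model
over the ring of integers of `K_v`" — for the once-punctured elliptic curve: multiplicative, hence
semistable, reduction of `E_F` at the places of `F` under `V^bad_mod`; PROVED from Def. 3.1 (b).
[claim: Mochizuki2012, status: disputed] -/
theorem isSemistableAt_of_mem_VFbad (v : FinitePlace F) (hv : v ∈ D.VFbad) :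
    E.HasMultiplicativeReductionAt v.maximalIdeal ∧ E.IsSemistableAt v.maximalIdeal :=
  ⟨D.multiplicative_over_VbadMod v hv, (D.multiplicative_over_VbadMod v hv).isSemistableAt⟩

include D in
/-- Remark 3.1.4 (the general part), p. 65: "each `v ∈ V̲^good ∩ V̲^non` … `X_v` admits a stable
model" — semistability of `E_F` at every finite place, which is Def. 3.1 (b); PROVED (restated).
[claim: Mochizuki2012, status: disputed] -/
theorem isSemistableAt (v : HeightOneSpectrum (𝓞 F)) : E.IsSemistableAt v := D.isSemistable v

include D in
/-- Remark 3.1.6, p. 66: "[in [EtTh] §2] one must in fact assume that the integer `l` is odd in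
order for the quotient `Δ_X` to be well-defined. Since … in the present series of papers, this is
the only case that is of interest …" — for initial Θ-data, `l` is odd; PROVED from Def. 3.1 (c).
[claim: Mochizuki2012, status: disputed] -/
theorem l_odd : Odd l :=
  D.l_prime.odd_of_ne_two (by have := D.five_le_l; omega)

/-- Remark 3.1.4, p. 65: "each `v ∈ V̲^bad` [which is necessarily prime to `l` — cf. Definition 3.1,
(c)]" — the residue characteristic of a place of `V^bad_mod` is not `l`; restated from Def. 3.1 (c).
[claim: Mochizuki2012, status: disputed] -/
theorem residueChar_ne_l (w : FinitePlace (fieldOfModuli E)) (hw : w ∈ D.VbadMod) :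
    residueChar w ≠ l :=
  D.l_ne_residueChar w hw

/-- Remark 3.1.5, first sentence, p. 65: "since the `3`-torsion points of `E_F` are rational over
`F`, and `F` is Galois over `F_mod`, it follows [cf., e.g., [IUTchIV], Proposition 1.8, (iv)] that
`K` is Galois over `F_mod`" — typed as the statement that the image of `K` in `F̄` is stable under
every ring automorphism of `F̄` fixing `F_mod` pointwise (a claim of the text; not proved here).
[claim: Mochizuki2012, status: disputed] -/
def KGaloisOverFieldOfModuli (_D : InitialThetaData F K Fbar E l P) : Prop :=
  ∀ σ : Fbar ≃+* Fbar,
    (∀ x : fieldOfModuli E, σ (algebraMap F Fbar (x : F)) = algebraMap F Fbar (x : F)) →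
      ∀ y : K, σ (algebraMap K Fbar y) ∈ Set.range (algebraMap K Fbar)

end InitialThetaData

end ForData

end Literature.IUT.HodgeTheaters
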